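import Mathlib

/-!
# Concavity of the one-leaf exponent map ⇒ the nonlinear response is at least the linear one (ρ ≥ 1)

Solo-blind programme, steady door R4c, paper §24.17 (g-vii)(6⁵)–(6⁶).

Numerically (sigma_mu_leaf.py, s37) the leafwise Floquet exponent of the carrier under an added
cross-stream shear `μ` is a CONCAVE function `σ(μ)` on every band leaf (meander ridge:
`σ ≈ .2791 + .117 μ − .296 μ²`, elliptic for `μ ≤ −.6`).  This file records the elementary consequence
that explains why the exact exponent map always suppresses the pattern MORE than its linearisation
(the measured ratio `ρ = ⟨q, δσ_NL⟩ / ⟨q, δσ_lin⟩ ≥ 1`):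

* `concave_tangent_le` : a concave `σ` with `σ'(0) = d` lies below its tangent, `σ μ ≤ σ 0 + d μ`;
* `weighted_response_le_linear` : for weights `q_i ≥ 0`, `Σ q_i (σ(μ_i) − σ 0) ≤ Σ q_i d μ_i`;
* `zero_mean_shear_lowers` : a `q`-mean-zero shear (the δ′-type contact spike) can only LOWER the
  `q`-weighted exponent (Jensen);
* `rho_ge_one` : if the linear response is a net reduction (`Σ q_i d μ_i < 0`) then `ρ ≥ 1`;
* `weighted_response_le_linear_quadratic` : with a uniform concavity modulus `κ` the deficit is at
  least `κ Σ q_i μ_i²`.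
-/

namespace Summit.AnomalousDissipation.AnomalousDissipation.Theorems

open Finset

/-- Tangent-line inequality at `0` for a concave function on `ℝ` with derivative `d` at `0`. -/
theorem concave_tangent_le (σ : ℝ → ℝ) (d : ℝ) (hc : ConcaveOn ℝ Set.univ σ)
    (hd : HasDerivAt σ d 0) (μ : ℝ) : σ μ ≤ σ 0 + d * μ := by
  rcases lt_trichotomy 0 μ with hμ | hμ | hμ
  · have h := hc.slope_le_of_hasDerivAt (Set.mem_univ 0) (Set.mem_univ μ) hμ hd
    rw [slope_def_field, div_le_iff₀ (by linarith)] at h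
    linarith
  · subst hμ; simp
  · have h := hc.le_slope_of_hasDerivAt (Set.mem_univ μ) (Set.mem_univ 0) hμ hd
    rw [slope_def_field, le_div_iff₀ (by linarith)] at h
    linarith

/-- The `q`-weighted exact response is below the `q`-weighted linear response. -/
theorem weighted_response_le_linear {ι : Type*} (t : Finset ι) (q μ : ι → ℝ) (σ : ℝ → ℝ) (d : ℝ)
    (hc : ConcaveOn ℝ Set.univ σ) (hd : HasDerivAt σ d 0) (hq : ∀ i ∈ t, 0 ≤ q i) :
    ∑ i ∈ t, q i * (σ (μ i) - σ 0) ≤ ∑ i ∈ t, q i * (d * μ i) := by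
  apply Finset.sum_le_sum
  intro i hi
  have h := concave_tangent_le σ d hc hd (μ i)
  exact mul_le_mul_of_nonneg_left (by linarith) (hq i hi)

/-- Jensen form: a `q`-mean-zero shear distribution can only lower the `q`-weighted exponent. -/
theorem zero_mean_shear_lowers {ι : Type*} (t : Finset ι) (q μ : ι → ℝ) (σ : ℝ → ℝ) (d : ℝ)
    (hc : ConcaveOn ℝ Set.univ σ) (hd : HasDerivAt σ d 0) (hq : ∀ i ∈ t, 0 ≤ q i)
    (h0 : ∑ i ∈ t, q i * μ i = 0) :
    ∑ i ∈ t, q i * σ (μ i) ≤ (∑ i ∈ t, q i) * σ 0 := by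
  have h := weighted_response_le_linear t q μ σ d hc hd hq
  have e1 : ∑ i ∈ t, q i * (d * μ i) = d * ∑ i ∈ t, q i * μ i := by
    rw [Finset.mul_sum]; exact Finset.sum_congr rfl (fun i _ => by ring)
  have e2 : ∑ i ∈ t, q i * (σ (μ i) - σ 0) = ∑ i ∈ t, q i * σ (μ i) - (∑ i ∈ t, q i) * σ 0 := by
    rw [Finset.sum_mul, ← Finset.sum_sub_distrib]; exact Finset.sum_congr rfl (fun i _ => by ring)
  rw [e1, h0, mul_zero, e2] at h
  linarith

/-- `ρ ≥ 1`: if the linear `q`-weighted response is a net reduction, the exact one is at least as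
large a reduction, so their ratio is at least one. -/
theorem rho_ge_one {ι : Type*} (t : Finset ι) (q μ : ι → ℝ) (σ : ℝ → ℝ) (d : ℝ)
    (hc : ConcaveOn ℝ Set.univ σ) (hd : HasDerivAt σ d 0) (hq : ∀ i ∈ t, 0 ≤ q i)
    (hL : ∑ i ∈ t, q i * (d * μ i) < 0) :
    1 ≤ (∑ i ∈ t, q i * (σ (μ i) - σ 0)) / (∑ i ∈ t, q i * (d * μ i)) := by
  have h := weighted_response_le_linear t q μ σ d hc hd hq
  rw [le_div_iff_of_neg hL]
  linarith

/-- Quantitative version with a uniform concavity modulus `κ`: the deficit of the exact response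
below the linear one is at least `κ Σ q_i μ_i²`. -/
theorem weighted_response_le_linear_quadratic {ι : Type*} (t : Finset ι) (q μ : ι → ℝ)
    (σ : ℝ → ℝ) (d κ : ℝ) (hκ : ∀ x, σ x ≤ σ 0 + d * x - κ * x ^ 2) (hq : ∀ i ∈ t, 0 ≤ q i) :
    ∑ i ∈ t, q i * (σ (μ i) - σ 0) ≤ ∑ i ∈ t, q i * (d * μ i) - κ * ∑ i ∈ t, q i * μ i ^ 2 := by
  have e : ∑ i ∈ t, q i * (d * μ i) - κ * ∑ i ∈ t, q i * μ i ^ 2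
      = ∑ i ∈ t, q i * (d * μ i - κ * μ i ^ 2) := by
    rw [Finset.mul_sum, ← Finset.sum_sub_distrib]; exact Finset.sum_congr rfl (fun i _ => by ring)
  rw [e]
  apply Finset.sum_le_sum
  intro i hi
  have h := hκ (μ i)
  exact mul_le_mul_of_nonneg_left (by linarith) (hq i hi)

end Summit.AnomalousDissipation.AnomalousDissipation.Theorems
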